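import Summits.SmoothPoincare4.SmoothPoincare4.Theorems.CylinderEntropySliceIsolationStubCertMidLow
import Mathlib
import HarnessLib

/-!
# Two-atom mid-low-scale certificate for the conformal kernel domination (stub `stub_certMidLow2`)

Helper for the line `conformal-kernel-domination` of the crux
`Summit.SmoothPoincare4.SmoothPoincare4.Theses.CylinderEntropy.SliceIsolation` (crux item
stmt-SmoothPoincare4-7632).  In the normalised variables `T = t/‖y‖² > 0`, `u = z₅ − log ‖y‖`,
`s = ⟨z', ŷ⟩ ∈ [−1, 1]` the Jacobian-weighted pulled-back Euclidean Gaussian kernel times `V = 8π²/3` is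
`pulled(T,u,s) = (8π²/3)·((4πT)²)⁻¹·exp(4u)·exp(−(exp(2u) − 2·exp(u)·s + 1)/(4T))`.
We extend the landed one-atom certificate (`CylinderEntropySliceIsolationStubCertMidLow.lean`,
`T ≤ 2·10⁻⁴`) to the range `2·10⁻⁴ ≤ T ≤ 10⁻³` with TWO broadened on-axis cylinder ("zonal") kernels plus an
area atom, of total mass `w₁ + w₂ + c ≤ 147/100`.

Write `r = eᵘ`, `Q = (r − 1)² + 2r(1 − s)`, `θ = arccos s`; `pulled = (1/(6T²)) e^{4u − Q/4T}`.
Constants: `c = 1/50`; near region `Q ≤ q₀ := 19/250` (so `r ≥ 18/25` there), split at the height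
`r = ρ := 8/9`.
* ATOM 1 (`r ≥ 8/9`): `τ₁ = (142/125) T`, shifted centre `σ₁ = 8τ₁`, `w₁ = (142/125)² e^{16τ₁}`; with the
  Cheeger–Yau minorant (`CheegerYauZonalSphereFour_holds`, packaged in `certMidLow2_atom`) and the exact
  cancellation of the linear terms produced by the shift, it suffices that `θ² + u² ≤ (142/125) Q`
  (`certMidLow2_angle`, `certMidLow2_height`).
* ATOM 2 (`18/25 ≤ r < 8/9`, the lower flank): centre `σ₂ = log(8/9)` at the TOP of its range,
  `τ₂ = (25/18) T`, `w₂ = (25/18)² (8/9)⁴ e^{−1/(324T)}` (`(1+κ₂)²` times the value of `6T²·pulled` at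
  `(u, s) = (σ₂, 1)`); the exponent comparison reduces to `θ² ≤ (25/18)·2r(1 − s)` and
  `(u − σ₂)² ≤ (25/18)((1 − r)² − 1/81)` (`certMidLow2_lower`, from `σ₂ − u ≤ e^{σ₂−u} − 1 = (ρ − r)/r`).
* FAR region `Q > q₀`: `pulled ≤ c` (`certMidLow2_far`: `(4·10⁸/1083) x² ≤ eˣ` for `x = 19/(1000T) ≥ 19`
  when `r ≤ 2`, and `y⁴/24 ≤ eʸ` when `r > 2`).
Mass at `T ≤ 10⁻³`: `w₁ ≤ 1.315`, `w₂ ≤ 0.061`, `c = 0.02`.  The lower bound `1/5000 ≤ T` is only used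
through `0 < T`.
-/

noncomputable section

-- the registered namespace `Summit.SmoothPoincare4.SmoothPoincare4.Theorems…` repeats a component
set_option linter.dupNamespace false

namespace Summit.SmoothPoincare4.SmoothPoincare4.Theorems.CylinderEntropySliceIsolation

open Literature.Geometry.Riemannian Literature.Geometry.Riemannian.SphericalCylinderEntropy
open Literature.Geometry.Riemannian.SphericalCylinderConformal (le_one_of_cos_gt)

/-- The total mass of the two-atom certificate: for `0 < T ≤ 1/1000`,
`(142/125)² e^{(2272/125)T} + (25/18)² (8/9)⁴ e^{−1/(324T)} + 1/50 ≤ 147/100`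
(`eˣ ≤ 1 + x + x²` for `|x| ≤ 1`, and `e^{−1/(324T)} ≤ e^{−3} ≤ 1/20`). [folklore] -/
theorem certMidLow2_mass {T : ℝ} (hT0 : 0 < T) (hT : T ≤ 1 / 1000) :
    (142 / 125 : ℝ) ^ 2 * Real.exp (2272 / 125 * T) +
      (25 / 18 : ℝ) ^ 2 * (8 / 9) ^ 4 * Real.exp (-(1 / (324 * T))) + 1 / 50 ≤ 147 / 100 := by
  have hx : |(2272 / 125 * T : ℝ)| ≤ 1 := by rw [abs_le]; constructor <;> linarith
  have he' : Real.exp (2272 / 125 * T) ≤ 1 + 2272 / 125 * T + (2272 / 125 * T) ^ 2 := by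
    linarith [(abs_le.1 (Real.abs_exp_sub_one_sub_id_le hx)).2]
  have h1 : (142 / 125 : ℝ) ^ 2 * Real.exp (2272 / 125 * T) ≤ 1315 / 1000 := by
    nlinarith [he', mul_le_mul_of_nonneg_left hT hT0.le]
  have h3 : 3 ≤ 1 / (324 * T) := by rw [le_div_iff₀ (by positivity)]; linarith
  have he3 : Real.exp (-(1 / (324 * T))) ≤ Real.exp (-3) := Real.exp_le_exp.2 (by linarith)
  have he1 : (2.718 : ℝ) ≤ Real.exp 1 := by linarith [Real.exp_one_gt_d9]
  have hpow : Real.exp 1 ^ 3 = Real.exp 3 := by rw [← Real.exp_nat_mul]; norm_num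
  have h20 : (20 : ℝ) ≤ Real.exp 3 := by
    calc (20 : ℝ) ≤ 2.718 ^ 3 := by norm_num
      _ ≤ Real.exp 1 ^ 3 := pow_le_pow_left₀ (by norm_num) he1 3
      _ = Real.exp 3 := hpow
  have hem3 : Real.exp (-3) ≤ 1 / 20 := by
    rw [Real.exp_neg, inv_eq_one_div]; exact one_div_le_one_div_of_le (by norm_num) h20
  nlinarith [he3.trans hem3]

/-- For `x ≥ 19`, `(4·10⁸/1083) x² ≤ eˣ` (from `e ≥ 2.718`, `2.718¹⁹ ≥ 178·10⁶` and
`e^y ≥ 1 + y + y²/2` at `y = x − 19`). [folklore] -/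
theorem certMidLow2_exp_sq_le {x : ℝ} (hx : 19 ≤ x) : 400000000 / 1083 * x ^ 2 ≤ Real.exp x := by
  have he1 : (2.718 : ℝ) ≤ Real.exp 1 := by linarith [Real.exp_one_gt_d9]
  have hpow : Real.exp 1 ^ 19 = Real.exp 19 := by rw [← Real.exp_nat_mul]; norm_num
  have h19 : (178000000 : ℝ) ≤ Real.exp 19 := by
    calc (178000000 : ℝ) ≤ 2.718 ^ 19 := by norm_num
      _ ≤ Real.exp 1 ^ 19 := pow_le_pow_left₀ (by norm_num) he1 19
      _ = Real.exp 19 := hpow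
  obtain ⟨y, hy0, rfl⟩ : ∃ y : ℝ, 0 ≤ y ∧ x = 19 + y := ⟨x - 19, by linarith, by ring⟩
  rw [Real.exp_add 19 y]
  calc 400000000 / 1083 * (19 + y) ^ 2 ≤ 178000000 * (1 + y + y ^ 2 / 2) := by
        nlinarith [sq_nonneg y]
    _ ≤ Real.exp 19 * Real.exp y :=
        mul_le_mul h19 (Real.quadratic_le_exp_of_nonneg hy0) (by positivity) (Real.exp_pos _).le

/-- **Far region.** If `0 < T ≤ 1/1000`, `(eᵘ − 1)² ≤ Q` and `Q > 19/250`, then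
`(1/(6T²)) e^{4u} e^{−Q/4T} ≤ 1/50`: the far region lies below the area atom. [folklore] -/
theorem certMidLow2_far {T u Q : ℝ} (hT : 0 < T) (hT' : T ≤ 1 / 1000)
    (hQ1 : (Real.exp u - 1) ^ 2 ≤ Q) (hQ2 : (19 / 250 : ℝ) < Q) :
    1 / (6 * T ^ 2) * Real.exp (4 * u) * Real.exp (-Q / (4 * T)) ≤ 1 / 50 := by
  have hr0 : 0 < Real.exp u := Real.exp_pos u
  have h4u : Real.exp (4 * u) = Real.exp u ^ 4 := by rw [← Real.exp_nat_mul]; norm_num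
  rcases le_or_gt (Real.exp u) 2 with hle | hgt
  · -- `eᵘ ≤ 2`: `e^{4u} ≤ 16` and `e^{−Q/4T} ≤ e^{−x}`, `x = 19/(1000T) ≥ 19`
    set x : ℝ := 19 / (1000 * T) with hx
    have hx19 : 19 ≤ x := by rw [hx, le_div_iff₀ (by positivity)]; nlinarith
    have hex : 400000000 / 1083 * x ^ 2 ≤ Real.exp x := certMidLow2_exp_sq_le hx19
    have h16 : Real.exp (4 * u) ≤ 16 := by
      rw [h4u]; exact (pow_le_pow_left₀ hr0.le hle 4).trans (by norm_num)
    have hE : Real.exp (-Q / (4 * T)) ≤ (Real.exp x)⁻¹ := by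
      rw [← Real.exp_neg]
      apply Real.exp_le_exp.2
      have h1 : x * (4 * T) = 19 / 250 := by rw [hx]; field_simp; norm_num
      rw [div_le_iff₀ (by positivity : (0 : ℝ) < 4 * T)]
      linarith
    have hkey : 400 / 3 ≤ T ^ 2 * Real.exp x := by
      have h1 : T ^ 2 * (400000000 / 1083 * x ^ 2) = 400 / 3 := by rw [hx]; field_simp; norm_num
      rw [← h1]
      exact mul_le_mul_of_nonneg_left hex (sq_nonneg T)
    have hTe : 0 < T ^ 2 * Real.exp x := by positivity
    calc 1 / (6 * T ^ 2) * Real.exp (4 * u) * Real.exp (-Q / (4 * T))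
        ≤ 1 / (6 * T ^ 2) * 16 * (Real.exp x)⁻¹ := by gcongr
      _ = 8 / 3 / (T ^ 2 * Real.exp x) := by field_simp; ring
      _ ≤ 8 / 3 / (400 / 3) := by gcongr
      _ = 1 / 50 := by norm_num
  · -- `eᵘ > 2`: `Q ≥ e^{2u}/4`, `y = e^{2u}/(16T)`, `y⁴/24 ≤ eʸ`
    set r := Real.exp u with hr
    have hprod : 0 ≤ (r - 2) * (3 * r - 2) := mul_nonneg (by linarith) (by linarith)
    have hQr : r ^ 2 / 4 ≤ Q := by nlinarith [hprod, hQ1]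
    set y : ℝ := r ^ 2 / (16 * T) with hy
    have hy0 : 0 ≤ y := by positivity
    have hE : Real.exp (-Q / (4 * T)) ≤ Real.exp (-y) := by
      apply Real.exp_le_exp.2
      rw [hy, div_le_iff₀ (by positivity : (0 : ℝ) < 4 * T)]
      have h1 : r ^ 2 / (16 * T) * (4 * T) = r ^ 2 / 4 := by field_simp; ring
      linarith
    have hexp : y ^ 4 / 24 ≤ Real.exp y := by
      have h := Real.pow_div_factorial_le_exp y hy0 4; norm_num [Nat.factorial] at h; exact h
    have hr2 : 4 ≤ r ^ 2 := by nlinarith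
    have hr4 : 16 ≤ r ^ 4 := by nlinarith [hr2]
    have hT2 : T ^ 2 ≤ 1 / 1000000 := by nlinarith
    have halg : 1 / (6 * T ^ 2) * r ^ 4 ≤ 1 / 50 * (y ^ 4 / 24) := by
      have e1 : 1 / 50 * (y ^ 4 / 24) = r ^ 8 / (78643200 * T ^ 4) := by rw [hy]; field_simp; ring
      have e2 : 1 / (6 * T ^ 2) * r ^ 4 = r ^ 4 / (6 * T ^ 2) := by ring
      rw [e1, e2, div_le_div_iff₀ (by positivity) (by positivity)]
      have h := mul_nonneg (mul_nonneg (pow_nonneg hT.le 2) (pow_nonneg hr0.le 4))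
        (show (0 : ℝ) ≤ 6 * r ^ 4 - 78643200 * T ^ 2 by nlinarith [hr4, hT2])
      nlinarith [h]
    calc 1 / (6 * T ^ 2) * Real.exp (4 * u) * Real.exp (-Q / (4 * T))
        ≤ 1 / (6 * T ^ 2) * r ^ 4 * Real.exp (-y) := by rw [h4u]; gcongr
      _ ≤ 1 / 50 * (y ^ 4 / 24) * Real.exp (-y) := by gcongr
      _ ≤ 1 / 50 * Real.exp y * Real.exp (-y) := by gcongr
      _ = 1 / 50 := by rw [mul_assoc, ← Real.exp_add, add_neg_cancel, Real.exp_zero, mul_one]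

/-- **Angular part of the near-region comparison** (joint in the height `r` and the angle): if `|s| ≤ 1`,
`r ≥ 18/25`, `(r − 1)² + 2r(1 − s) ≤ 19/250` and `K·(r − (5/43)(19/250 − (r−1)²)) ≥ 1` with `K ≥ 0`, then
`arccos(s)² ≤ K · 2r(1 − s)`: with `θ = arccos s ≤ 1`, `1 − cos θ ≥ θ²/2 − 5θ⁴/96` (`Real.cos_bound`)
and `rθ² ≤ (96/43) r (1 − s) ≤ (48/43)(19/250 − (r−1)²)`. [folklore] -/
theorem certMidLow2_angle {r s K : ℝ} (hs1 : -1 ≤ s) (hs2 : s ≤ 1) (hr : 18 / 25 ≤ r)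
    (hQ : (r - 1) ^ 2 + 2 * r * (1 - s) ≤ 19 / 250) (hK0 : 0 ≤ K)
    (hK : 1 ≤ K * (r - 5 / 43 * (19 / 250 - (r - 1) ^ 2))) :
    (Real.arccos s) ^ 2 ≤ K * (2 * r * (1 - s)) := by
  set θ := Real.arccos s with hθ
  have hθ0 : 0 ≤ θ := Real.arccos_nonneg s
  have hθπ : θ ≤ Real.pi := Real.arccos_le_pi s
  have hcos : Real.cos θ = s := Real.cos_arccos hs1 hs2
  have h1s0 : 0 ≤ 1 - s := by linarith
  have hr0 : 0 < r := by linarith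
  have hsq0 : 0 ≤ (r - 1) ^ 2 := sq_nonneg _
  have h1s : 1 - s ≤ 19 / 360 := by nlinarith [mul_nonneg (show (0 : ℝ) ≤ r - 18 / 25 by linarith) h1s0]
  have hcgt : 53 / 96 < Real.cos θ := by rw [hcos]; linarith
  have hθ1 : θ ≤ 1 := le_one_of_cos_gt hθπ hcgt
  have hb := Real.cos_bound (x := θ) (by rw [abs_of_nonneg hθ0]; exact hθ1)
  rw [abs_of_nonneg hθ0, hcos] at hb
  have hcb : s ≤ 1 - θ ^ 2 / 2 + θ ^ 4 * (5 / 96) := by linarith [(abs_sub_le_iff.1 hb).1]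
  have hθ2 : 0 ≤ θ ^ 2 := sq_nonneg θ
  have hθsq1 : θ ^ 2 ≤ 1 := by nlinarith
  have hθ4 : θ ^ 4 ≤ θ ^ 2 := by nlinarith [hθ2]
  have hθsq : 43 / 96 * θ ^ 2 ≤ 1 - s := by linarith
  -- `r θ² ≤ (48/43)(19/250 − (r−1)²)`
  have hrθ : r * θ ^ 2 ≤ 48 / 43 * (19 / 250 - (r - 1) ^ 2) := by
    nlinarith [mul_le_mul_of_nonneg_left hθsq hr0.le]
  -- `2r(1 − s) ≥ rθ² − (5/48) θ² (rθ²) ≥ θ² (r − (5/43)(19/250 − (r−1)²))`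
  have hlow : r * θ ^ 2 - 5 / 48 * θ ^ 2 * (r * θ ^ 2) ≤ 2 * r * (1 - s) := by
    rw [show r * θ ^ 2 - 5 / 48 * θ ^ 2 * (r * θ ^ 2) = 2 * r * (θ ^ 2 / 2 - θ ^ 4 * (5 / 96)) by ring]
    exact mul_le_mul_of_nonneg_left (by linarith) (by linarith)
  have hmain : θ ^ 2 * (r - 5 / 43 * (19 / 250 - (r - 1) ^ 2)) ≤ 2 * r * (1 - s) := by
    nlinarith [mul_le_mul_of_nonneg_left hrθ (show (0 : ℝ) ≤ 5 / 48 * θ ^ 2 by positivity)]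
  calc θ ^ 2 = θ ^ 2 * 1 := by ring
    _ ≤ θ ^ 2 * (K * (r - 5 / 43 * (19 / 250 - (r - 1) ^ 2))) := mul_le_mul_of_nonneg_left hK hθ2
    _ = K * (θ ^ 2 * (r - 5 / 43 * (19 / 250 - (r - 1) ^ 2))) := by ring
    _ ≤ K * (2 * r * (1 - s)) := mul_le_mul_of_nonneg_left hmain hK0

/-- **Radial part for the first atom.** If `eᵘ ≥ 8/9` then `u² ≤ (142/125)(eᵘ − 1)²`: for `u ≥ 0`,
`eᵘ − 1 ≥ u`; for `u = −x < 0`, `x ≤ 13/110` and `1 − e^{−x} ≥ x(1 − x/2)` (from `eˣ ≥ 1 + x + x²/2`),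
with `(142/125)(1 − 13/220)² ≥ 1`. [folklore] -/
theorem certMidLow2_height {u : ℝ} (hr : 8 / 9 ≤ Real.exp u) :
    u ^ 2 ≤ 142 / 125 * (Real.exp u - 1) ^ 2 := by
  rcases le_or_gt 0 u with hu0 | hu0
  · -- `0 ≤ u ≤ eᵘ - 1`
    have h1 : u ≤ Real.exp u - 1 := by linarith [Real.add_one_le_exp u]
    nlinarith [pow_le_pow_left₀ hu0 h1 2, sq_nonneg (Real.exp u - 1)]
  · -- `u < 0`, `x = -u`
    obtain ⟨x, hx0, rfl⟩ : ∃ x : ℝ, 0 < x ∧ u = -x := ⟨-u, by linarith, by ring⟩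
    have hprod : Real.exp x * Real.exp (-x) = 1 := by rw [← Real.exp_add, add_neg_cancel, Real.exp_zero]
    have hxpos : 0 < Real.exp x := Real.exp_pos x
    have hq : 1 + x + x ^ 2 / 2 ≤ Real.exp x := Real.quadratic_le_exp_of_nonneg hx0.le
    have h1 : Real.exp x * (8 / 9) ≤ Real.exp x * Real.exp (-x) := mul_le_mul_of_nonneg_left hr hxpos.le
    rw [hprod] at h1
    -- `x ≤ 13/110` (as `1 + x + x²/2 ≤ eˣ ≤ 9/8`)
    have hx1 : x ≤ 13 / 110 := by nlinarith
    -- `e^{-x} ≤ 1 - x + x²/2`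
    have hpos : 0 ≤ 1 - x + x ^ 2 / 2 := by nlinarith [sq_nonneg (x - 1)]
    have hEu : Real.exp (-x) ≤ 1 - x + x ^ 2 / 2 := by
      by_contra hcon
      push Not at hcon
      have h1 : Real.exp x * (1 - x + x ^ 2 / 2) < Real.exp x * Real.exp (-x) :=
        mul_lt_mul_of_pos_left hcon hxpos
      have h2 : (1 + x + x ^ 2 / 2) * (1 - x + x ^ 2 / 2) ≤ Real.exp x * (1 - x + x ^ 2 / 2) :=
        mul_le_mul_of_nonneg_right hq hpos
      rw [hprod] at h1
      rw [show (1 + x + x ^ 2 / 2) * (1 - x + x ^ 2 / 2) = 1 + x ^ 4 / 4 by ring] at h2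
      nlinarith [pow_nonneg hx0.le 4]
    -- `1 - e^{-x} ≥ x (1 - x/2) ≥ 0`
    have hlow : x * (1 - x / 2) ≤ 1 - Real.exp (-x) := by nlinarith
    have hl0 : 0 ≤ x * (1 - x / 2) := mul_nonneg hx0.le (by linarith)
    have h5 : (x * (1 - x / 2)) ^ 2 ≤ (1 - Real.exp (-x)) ^ 2 := pow_le_pow_left₀ hl0 hlow 2
    have h6a : (207 / 220 : ℝ) ≤ 1 - x / 2 := by linarith
    have h6 : 1 ≤ 142 / 125 * (1 - x / 2) ^ 2 := by
      nlinarith [mul_le_mul h6a h6a (by norm_num) (by linarith)]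
    calc (-x) ^ 2 = x ^ 2 := by ring
      _ ≤ 142 / 125 * (1 - x / 2) ^ 2 * x ^ 2 := by
          nlinarith [mul_le_mul_of_nonneg_right h6 (sq_nonneg x)]
      _ = 142 / 125 * (x * (1 - x / 2)) ^ 2 := by ring
      _ ≤ 142 / 125 * (1 - Real.exp (-x)) ^ 2 := mul_le_mul_of_nonneg_left h5 (by norm_num)
      _ = 142 / 125 * (Real.exp (-x) - 1) ^ 2 := by ring

/-- **Radial part for the second (lower-flank) atom**, centred at `σ₂ = log(8/9)`: if `18/25 ≤ eᵘ < 8/9`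
then `(u − log(8/9))² ≤ (25/18)((eᵘ − 1)² − 1/81)`.  With `r = eᵘ`, `d = σ₂ − u > 0`:
`d ≤ e^d − 1 = (8/9 − r)/r`, and `(8/9 − r) ≤ (25/18) r² (10/9 − r)` on `[18/25, 8/9]`. [folklore] -/
theorem certMidLow2_lower {u : ℝ} (hlo : 18 / 25 ≤ Real.exp u) (hhi : Real.exp u < 8 / 9) :
    (u - Real.log (8 / 9)) ^ 2 ≤ 25 / 18 * ((Real.exp u - 1) ^ 2 - 1 / 81) := by
  set r := Real.exp u with hr
  set σ := Real.log (8 / 9 : ℝ) with hσ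
  have hσexp : Real.exp σ = 8 / 9 := Real.exp_log (by norm_num)
  have hr0 : 0 < r := Real.exp_pos u
  have huσ : u < σ := Real.exp_lt_exp.1 (by rwa [hσexp])
  have hd : Real.exp (σ - u) = 8 / 9 / r := by rw [Real.exp_sub, hσexp]
  have hd1 : σ - u ≤ (8 / 9 - r) / r := by
    have := Real.add_one_le_exp (σ - u)
    rw [hd] at this; rw [sub_div, div_self hr0.ne']; linarith
  have hsq : (u - σ) ^ 2 ≤ ((8 / 9 - r) / r) ^ 2 := by
    rw [show (u - σ) ^ 2 = (σ - u) ^ 2 by ring]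
    exact pow_le_pow_left₀ (by linarith) hd1 2
  have hpoly : ((8 / 9 - r) / r) ^ 2 ≤ 25 / 18 * ((r - 1) ^ 2 - 1 / 81) := by
    rw [div_pow, div_le_iff₀ (by positivity)]
    have h1 : 0 ≤ 8 / 9 - r := by linarith
    have h2 : 8 / 9 - r ≤ r * (10 / 9 - r) := by
      nlinarith [mul_nonneg (show (0 : ℝ) ≤ r - 18 / 25 by linarith) h1]
    have h3 : r * (10 / 9 - r) ≤ 25 / 18 * r ^ 2 * (10 / 9 - r) := by
      nlinarith [mul_nonneg (mul_nonneg hr0.le (show (0 : ℝ) ≤ 10 / 9 - r by linarith))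
        (show (0 : ℝ) ≤ 25 / 18 * r - 1 by linarith)]
    nlinarith [mul_le_mul_of_nonneg_left (h2.trans h3) h1]
  exact hsq.trans hpoly

/-- **One broadened atom from an exponent comparison.** At scale `τ = kT`, the Cheeger–Yau minorant
`(8π²/3)(4πτ)⁻² e^{−θ²/4τ} ≤ 𝔥(τ, cos θ)` and `(8π²/3)(4πT)⁻² = k² (8π²/3)(4πτ)⁻²` turn
`4u − Q/4T ≤ ℓ − (θ² + (u−σ)²)/4τ` into `pulled ≤ k² e^ℓ · 𝔥(τ, s) e^{−(u−σ)²/4τ}`. [folklore] -/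
theorem certMidLow2_atom {T k ℓ w u σ Q s : ℝ} (hT : 0 < T) (hk : 0 < k) (hs1 : -1 ≤ s) (hs2 : s ≤ 1)
    (hw : k ^ 2 * Real.exp ℓ = w)
    (hkey : 4 * u + -Q / (4 * T) ≤
      ℓ + (-(Real.arccos s) ^ 2 / (4 * (k * T)) + -(u - σ) ^ 2 / (4 * (k * T)))) :
    (8 * Real.pi ^ 2 / 3) * ((4 * Real.pi * T) ^ 2)⁻¹ * Real.exp (4 * u) * Real.exp (-Q / (4 * T)) ≤
      w * (zonal (k * T) s * Real.exp (-(u - σ) ^ 2 / (4 * (k * T)))) := by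
  have hτ0 : 0 < k * T := mul_pos hk hT
  have hCY := CheegerYauZonalSphereFour_holds (k * T) hτ0 s hs1 hs2
  have hexp : Real.exp (4 * u) * Real.exp (-Q / (4 * T)) ≤ Real.exp ℓ *
      (Real.exp (-(Real.arccos s) ^ 2 / (4 * (k * T))) * Real.exp (-(u - σ) ^ 2 / (4 * (k * T)))) := by
    rw [← Real.exp_add, ← Real.exp_add, ← Real.exp_add]
    exact Real.exp_le_exp.2 hkey
  have hTne : T ≠ 0 := hT.ne'
  have hkne : k ≠ 0 := hk.ne'
  have hπ : Real.pi ≠ 0 := Real.pi_ne_zero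
  have hpref : (8 * Real.pi ^ 2 / 3) * ((4 * Real.pi * T) ^ 2)⁻¹ =
      k ^ 2 * ((8 * Real.pi ^ 2 / 3) * ((4 * Real.pi * (k * T)) ^ 2)⁻¹) := by
    field_simp
  rw [← hw]
  calc (8 * Real.pi ^ 2 / 3) * ((4 * Real.pi * T) ^ 2)⁻¹ * Real.exp (4 * u) * Real.exp (-Q / (4 * T))
      = (8 * Real.pi ^ 2 / 3) * ((4 * Real.pi * T) ^ 2)⁻¹ *
          (Real.exp (4 * u) * Real.exp (-Q / (4 * T))) := by ring
    _ ≤ (8 * Real.pi ^ 2 / 3) * ((4 * Real.pi * T) ^ 2)⁻¹ * (Real.exp ℓ *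
          (Real.exp (-(Real.arccos s) ^ 2 / (4 * (k * T))) * Real.exp (-(u - σ) ^ 2 / (4 * (k * T))))) :=
        mul_le_mul_of_nonneg_left hexp (by positivity)
    _ = k ^ 2 * Real.exp ℓ *
          (((8 * Real.pi ^ 2 / 3) * ((4 * Real.pi * (k * T)) ^ 2)⁻¹ *
              Real.exp (-(Real.arccos s) ^ 2 / (4 * (k * T)))) * Real.exp (-(u - σ) ^ 2 / (4 * (k * T)))) := by
        rw [hpref]; ring
    _ ≤ k ^ 2 * Real.exp ℓ * (zonal (k * T) s * Real.exp (-(u - σ) ^ 2 / (4 * (k * T)))) := by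
        gcongr

/-- **Two-atom mid-low-scale certificate** (`2·10⁻⁴ ≤ T ≤ 10⁻³`): with `τ₁ = (142/125) T`, `σ₁ = 8τ₁`,
`w₁ = (142/125)² e^{(2272/125)T}`, `σ₂ = log(8/9)`, `τ₂ = (25/18) T`, `w₂ = (25/18)² (8/9)⁴ e^{−1/(324T)}`,
`c = 1/50` (mass `≤ 147/100`) the two broadened on-axis cylinder kernels plus the area atom dominate the
Jacobian-weighted pulled-back Euclidean Gaussian kernel times `V = 8π²/3` on `ℝ × [−1,1]`.  Registered stub
`stub_certMidLow2` of the line `conformal-kernel-domination`. [folklore] -/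
theorem stub_certMidLow2 :
    ∀ T : ℝ, 1 / 5000 ≤ T → T ≤ 1 / 1000 → ∃ σ₁ τ₁ w₁ σ₂ τ₂ w₂ c : ℝ, 0 < τ₁ ∧ 0 < τ₂ ∧ 0 ≤ w₁ ∧ 0 ≤ w₂ ∧ 0 ≤ c ∧ w₁ + w₂ + c ≤ 147 / 100 ∧
      ∀ u s : ℝ, -1 ≤ s → s ≤ 1 →
        (8 * Real.pi ^ 2 / 3) * ((4 * Real.pi * T) ^ 2)⁻¹ * Real.exp (4 * u) *
            Real.exp (-(Real.exp (2 * u) - 2 * Real.exp u * s + 1) / (4 * T)) ≤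
          w₁ * (zonal τ₁ s * Real.exp (-(u - σ₁) ^ 2 / (4 * τ₁))) + w₂ * (zonal τ₂ s * Real.exp (-(u - σ₂) ^ 2 / (4 * τ₂))) + c := by
  intro T hT1 hT2
  have hT : 0 < T := by linarith
  refine ⟨1136 / 125 * T, 142 / 125 * T, (142 / 125) ^ 2 * Real.exp (2272 / 125 * T), Real.log (8 / 9),
    25 / 18 * T, (25 / 18) ^ 2 * (8 / 9) ^ 4 * Real.exp (-(1 / (324 * T))), 1 / 50, by positivity,
    by positivity, by positivity, by positivity, by norm_num, certMidLow2_mass hT hT2,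
    fun u s hs1 hs2 => ?_⟩
  have hTne : T ≠ 0 := hT.ne'
  have hτ₁0 : (0 : ℝ) < 142 / 125 * T := by positivity
  have hτ₂0 : (0 : ℝ) < 25 / 18 * T := by positivity
  have hσ₂exp : Real.exp (Real.log (8 / 9)) = 8 / 9 := Real.exp_log (by norm_num)
  -- the Euclidean defect `Q`
  set Q : ℝ := (Real.exp u - 1) ^ 2 + 2 * Real.exp u * (1 - s) with hQ
  have hQeq : Real.exp (2 * u) - 2 * Real.exp u * s + 1 = Q := by
    have h2 : Real.exp (2 * u) = Real.exp u ^ 2 := by rw [← Real.exp_nat_mul]; norm_num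
    rw [h2, hQ]; ring
  rw [hQeq]
  -- positivity of the two atoms (Cheeger–Yau)
  have hZ₁ : 0 < zonal (142 / 125 * T) s :=
    lt_of_lt_of_le (by positivity) (CheegerYauZonalSphereFour_holds _ hτ₁0 s hs1 hs2)
  have hZ₂ : 0 < zonal (25 / 18 * T) s :=
    lt_of_lt_of_le (by positivity) (CheegerYauZonalSphereFour_holds _ hτ₂0 s hs1 hs2)
  have hatom₁ : 0 ≤ (142 / 125 : ℝ) ^ 2 * Real.exp (2272 / 125 * T) *
      (zonal (142 / 125 * T) s * Real.exp (-(u - 1136 / 125 * T) ^ 2 / (4 * (142 / 125 * T)))) :=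
    mul_nonneg (by positivity) (mul_nonneg hZ₁.le (Real.exp_pos _).le)
  have hatom₂ : 0 ≤ (25 / 18 : ℝ) ^ 2 * (8 / 9) ^ 4 * Real.exp (-(1 / (324 * T))) *
      (zonal (25 / 18 * T) s * Real.exp (-(u - Real.log (8 / 9)) ^ 2 / (4 * (25 / 18 * T)))) :=
    mul_nonneg (by positivity) (mul_nonneg hZ₂.le (Real.exp_pos _).le)
  have hQ1 : (Real.exp u - 1) ^ 2 ≤ Q := by
    have h := mul_nonneg (mul_nonneg (zero_le_two (α := ℝ)) (Real.exp_pos u).le) (sub_nonneg.2 hs2)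
    rw [hQ]; linarith
  rcases le_or_gt Q (19 / 250) with hnear | hfar
  · -- NEAR REGION `Q ≤ 19/250`: `18/25 ≤ eᵘ`
    have hr72 : 18 / 25 ≤ Real.exp u := by
      have hu : (Real.exp u - 1) ^ 2 ≤ (7 / 25) ^ 2 := by linarith
      obtain ⟨hlo, -⟩ := abs_le_of_sq_le_sq' hu (by norm_num)
      linarith
    have hnear' : (Real.exp u - 1) ^ 2 + 2 * Real.exp u * (1 - s) ≤ 19 / 250 := hnear
    rcases le_or_gt (8 / 9) (Real.exp u) with hB | hC
    · -- ATOM 1 (`eᵘ ≥ 8/9`): `θ² + u² ≤ (142/125) Q`, and the shift `σ₁ = 8τ₁` cancels the linear terms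
      have hB0 : 0 ≤ Real.exp u - 8 / 9 := by linarith
      have hK : 1 ≤ 142 / 125 * (Real.exp u - 5 / 43 * (19 / 250 - (Real.exp u - 1) ^ 2)) := by
        nlinarith [mul_nonneg hB0 hB0]
      have hang := certMidLow2_angle hs1 hs2 hr72 hnear' (by norm_num) hK
      have hrad := certMidLow2_height hB
      have h4τ : 0 < 4 * (142 / 125 * T) := by positivity
      have hkey : 4 * u + -Q / (4 * T) ≤ 2272 / 125 * T +
          (-(Real.arccos s) ^ 2 / (4 * (142 / 125 * T)) +
            -(u - 1136 / 125 * T) ^ 2 / (4 * (142 / 125 * T))) := by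
        have h1 : -(142 / 125 * Q - u ^ 2) / (4 * (142 / 125 * T)) ≤
            -(Real.arccos s) ^ 2 / (4 * (142 / 125 * T)) :=
          div_le_div_of_nonneg_right (by rw [hQ]; linarith) h4τ.le
        have h2 : 4 * u + -Q / (4 * T) = 2272 / 125 * T +
            (-(142 / 125 * Q - u ^ 2) / (4 * (142 / 125 * T)) +
              -(u - 1136 / 125 * T) ^ 2 / (4 * (142 / 125 * T))) := by
          field_simp; ring
        linarith
      have := certMidLow2_atom hT (by norm_num) hs1 hs2 rfl hkey
      linarith
    · -- ATOM 2 (`18/25 ≤ eᵘ < 8/9`), centred at the top `σ₂ = log(8/9)` of its range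
      have hC0 : 0 ≤ Real.exp u - 18 / 25 := by linarith
      have hK : 1 ≤ 25 / 18 * (Real.exp u - 5 / 43 * (19 / 250 - (Real.exp u - 1) ^ 2)) := by
        nlinarith [mul_nonneg hC0 hC0]
      have hang := certMidLow2_angle hs1 hs2 hr72 hnear' (by norm_num) hK
      have hlow := certMidLow2_lower hr72 hC
      have huσ : u < Real.log (8 / 9) := Real.exp_lt_exp.1 (by rw [hσ₂exp]; exact hC)
      have hlin : 16 * (25 / 18 * T) * (u - Real.log (8 / 9)) ≤ 0 :=
        mul_nonpos_of_nonneg_of_nonpos (by positivity) (by linarith)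
      have h4τ : 0 < 4 * (25 / 18 * T) := by positivity
      have hkey : 4 * u + -Q / (4 * T) ≤ 4 * Real.log (8 / 9) + -(1 / (324 * T)) +
          (-(Real.arccos s) ^ 2 / (4 * (25 / 18 * T)) +
            -(u - Real.log (8 / 9)) ^ 2 / (4 * (25 / 18 * T))) := by
        have h1 : -(25 / 18 * (Q - 1 / 81) - 16 * (25 / 18 * T) * (u - Real.log (8 / 9)) -
              (u - Real.log (8 / 9)) ^ 2) / (4 * (25 / 18 * T)) ≤
            -(Real.arccos s) ^ 2 / (4 * (25 / 18 * T)) :=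
          div_le_div_of_nonneg_right (by rw [hQ]; linarith) h4τ.le
        have h2 : 4 * u + -Q / (4 * T) = 4 * Real.log (8 / 9) + -(1 / (324 * T)) +
            (-(25 / 18 * (Q - 1 / 81) - 16 * (25 / 18 * T) * (u - Real.log (8 / 9)) -
                (u - Real.log (8 / 9)) ^ 2) / (4 * (25 / 18 * T)) +
              -(u - Real.log (8 / 9)) ^ 2 / (4 * (25 / 18 * T))) := by
          field_simp; ring
        linarith
      have hw : (25 / 18 : ℝ) ^ 2 * Real.exp (4 * Real.log (8 / 9) + -(1 / (324 * T))) =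
          (25 / 18) ^ 2 * (8 / 9) ^ 4 * Real.exp (-(1 / (324 * T))) := by
        have h4 : Real.exp (4 * Real.log (8 / 9)) = (8 / 9 : ℝ) ^ 4 := by
          have := Real.exp_nat_mul (Real.log (8 / 9)) 4
          rw [hσ₂exp] at this
          exact_mod_cast this
        rw [Real.exp_add, h4]
        ring
      have := certMidLow2_atom hT (by norm_num) hs1 hs2 hw hkey
      linarith
  · -- FAR REGION
    have hpre : (8 * Real.pi ^ 2 / 3) * ((4 * Real.pi * T) ^ 2)⁻¹ = 1 / (6 * T ^ 2) := by
      have hπ : Real.pi ≠ 0 := Real.pi_ne_zero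
      field_simp; ring
    rw [hpre]
    linarith [certMidLow2_far hT hT2 hQ1 hfar]

end Summit.SmoothPoincare4.SmoothPoincare4.Theorems.CylinderEntropySliceIsolation

end
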